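import Summits.ABC.IUTFork.Conditional.FreyLegendreP6EngineInterval
import Mathlib.NumberTheory.LegendreSymbol.JacobiSymbol
import HarnessLib

/-!
# (P6) ENGINE, RECIPROCITY-MASK FORM — the Frobenius certificate as a residue-class bitmask, O(1) kernel work per level

PROOF-ONLY file (D-0012; 0 definitions, 0 `Prop` facts, no instance, no notation) of the abc-iut cell (seat abc-iut-w6-d102, gen 9;
row «C:P6-N3-BANDS-INH», engine v4). The interval engine `FreyP6Engine.condP6_ratPoint_interval_euler` (p541415) tests, at every
prime `l` of a band, that the discriminant `d = a_p² − 4p` of a Frobenius certificate is a quadratic non-residue mod `l` by EULER'S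
CRITERION `(m % l)^(l/2) % l = …` (`m = −d`); the kernel computes the full power, an integer of `(l/2)·log₂ m` bits, which is the wall
above `l ≈ 2·10⁵` (farm calibration 2026-08-27, this seat and abc-iut-w6-d055 g18). By QUADRATIC RECIPROCITY the Legendre symbol
`(d | l)` depends only on `l mod 4|d|` (Mathlib `jacobiSym.mod_right`), so the set of primes served by a certificate is a union of
residue classes mod `4m`: this file replaces the per-level power by ONE bit lookup in a precomputed mask `M` (`M / 2^(l % 4m) % 2 = 1`),
each set bit `r` being verified ONCE by a WITNESS prime `w = r + 4m·j` (the kernel searches the first `j` below a small bound) at which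
Euler's criterion is checked in the kernel, `w` being certified prime by the gcd filter together with the completeness of the prime list
(`prime_of_gcd_eq_one`).
* `FreyP6Engine.prime_of_gcd_eq_one` — converse of the filter: if every `2 ≤ x < B` has `gcd x P ≠ 1` (all primes below `B` divide `P`;
  a pure gcd `decide`), then `2 ≤ w < B²` with `gcd w P = 1` is prime.
* `FreyP6Engine.noroot_of_legendreSym_disc_eq_neg_one` / `not_isSquare_disc_of_noroot` — `X² − aX + p` is root-free mod `l` iff its
  discriminant is a non-square (`l ≠ 2`), in the two directions used.
* `FreyP6Engine.legendreSym_disc_eq_neg_one_of_euler` — the pure-`ℕ` Euler hypothesis of `noroot_zmod_of_euler` gives `(a² − 4p | w) = −1`.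
* `FreyP6Engine.legendreSym_eq_of_mod_four_mul_eq` — `(d | l) = (d | w)` for odd primes `l ≡ w (mod 4|d|)` (`jacobiSym.mod_right`).
* `FreyP6Engine.condP6_ratPoint_interval_mask` — **(P6) on a whole interval, mask form**: certificates `(p, a_p, m, M)`, the mask
  verification (one `decide` per certificate over `r < 4m`, witness search `j < jb`), the level walk over the two residue classes `l ≡ 1, 5 (mod 6)`
  (`List.range' s n 6`, two `decide`s per segment) with the per-level test `∃ t ∈ Certs, t.1 ≠ l ∧ M_t / 2^(l % 4m_t) % 2 = 1` ⇒
  `∀ l, l.Prime → lo ≤ l → l ≤ hi → Cor22.CondP6 (ratPoint λ) l`.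
HONEST SCOPE: classical arithmetic (Euler's criterion, quadratic reciprocity for the Jacobi symbol as in Mathlib, Mazur's Frobenius
certificate, a Tate transvection); an efficiency variant of existing kernel engines — nothing new is claimed about any datum; nothing about
[IUTchIII] Cor. 3.12; no side taken on any author; typed ≠ proved; no abc claim.
[cite: Mochizuki2012, IUTchIV Cor. 2.2 (ii) (P6) p.46] [cite: Mazur1978, §6 Prop. 6.3 (1) (p. 153)] [cite: Serre1973, Ch. I §3.3 Thm. 6]
[claim: Mochizuki2012, status: disputed] for every IUT sentence quoted.
-/

noncomputable section

open scoped Classical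
open WeierstrassCurve

namespace Summit.ABC.IUTFork.Conditional

namespace FreyP6Engine

open Literature.NumberTheory.EllipticCurves Literature.NumberTheory.DiophantineGeometry.GenEll
open Literature.NumberTheory.DiophantineGeometry Literature.IUT.LogVolume

/-- **Converse of the primality filter.** If every `2 ≤ x < B` shares a factor with `P` (i.e. every prime below `B` divides `P` — a pure
gcd check), then any `2 ≤ w < B²` coprime to `P` is prime (a proper divisor `m ≤ √w < B` would have `gcd m P ∣ gcd w P = 1`). [folklore] -/
theorem prime_of_gcd_eq_one {B P w : ℕ} (hFc : ∀ x ∈ List.range' 2 (B - 2), Nat.gcd x P ≠ 1)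
    (h2 : 2 ≤ w) (hw : w < B * B) (hg : Nat.gcd w P = 1) : w.Prime := by
  rw [Nat.prime_def_le_sqrt]
  refine ⟨h2, fun m hm2 hml hdvd => ?_⟩
  have hmB : m < B := lt_of_le_of_lt hml (Nat.sqrt_lt.mpr hw)
  have hmem : m ∈ List.range' 2 (B - 2) := List.mem_range'.2 ⟨m - 2, by omega, by omega⟩
  have hdiv : Nat.gcd m P ∣ Nat.gcd w P := Nat.gcd_dvd_gcd_of_dvd_left P hdvd
  rw [hg, Nat.dvd_one] at hdiv
  exact hFc m hmem hdiv

/-- If the discriminant `a² − 4p` is a non-square mod the prime `l` (Legendre symbol `−1`), then `X² − aX + p` has no root in `ZMod l`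
(a root `t` gives `(2t − a)² = a² − 4p`). [folklore] -/
theorem noroot_of_legendreSym_disc_eq_neg_one (l : ℕ) [Fact l.Prime] (a : ℤ) (p : ℕ)
    (h : legendreSym l (a ^ 2 - 4 * p) = -1) : ∀ t : ZMod l, t ^ 2 - (a : ZMod l) * t + (p : ZMod l) ≠ 0 := by
  intro t ht
  apply (legendreSym.eq_neg_one_iff l).1 h
  refine ⟨2 * t - a, ?_⟩
  push_cast
  linear_combination (-4 : ZMod l) * ht

/-- Conversely, for `l ≠ 2`: if `X² − aX + p` has no root in `ZMod l` then `a² − 4p` is a non-square there (a square root `s` gives the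
root `(a + s)/2`). [folklore] -/
theorem not_isSquare_disc_of_noroot (l : ℕ) [Fact l.Prime] (hl2 : l ≠ 2) (a : ℤ) (p : ℕ)
    (h : ∀ t : ZMod l, t ^ 2 - (a : ZMod l) * t + (p : ZMod l) ≠ 0) :
    ¬ IsSquare (((a ^ 2 - 4 * p : ℤ)) : ZMod l) := by
  rintro ⟨s, hs⟩
  have hchar : ringChar (ZMod l) ≠ 2 := by rw [ZMod.ringChar_zmod_n]; exact hl2
  have h2 : (2 : ZMod l) ≠ 0 := Ring.two_ne_zero hchar
  obtain ⟨i, hi⟩ : ∃ i : ZMod l, 2 * i = 1 := ⟨(2 : ZMod l)⁻¹, mul_inv_cancel₀ h2⟩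
  have hs' : (a : ZMod l) ^ 2 - 4 * (p : ZMod l) = s * s := by push_cast at hs; exact hs
  have h4 : (4 : ZMod l) ≠ 0 := by
    rw [show (4 : ZMod l) = 2 * 2 by norm_num]; exact mul_ne_zero h2 h2
  apply h (((a : ZMod l) + s) * i)
  apply (mul_eq_zero.1 (?_ : (4 : ZMod l) * _ = 0)).resolve_left h4
  linear_combination ((2 * i + 1) * ((a : ZMod l) + s) ^ 2 - 2 * (a : ZMod l) * ((a : ZMod l) + s)) * hi - hs'

/-- **Euler's criterion at a witness prime, as a Legendre symbol.** With `m = 4p − a²` and the pure-`ℕ` hypothesis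
`(m % w)^(w/2) % w = (w ≡ 1 mod 4 ? w − 1 : 1)` of `noroot_zmod_of_euler`: `(a² − 4p | w) = −1`. [folklore] -/
theorem legendreSym_disc_eq_neg_one_of_euler (w : ℕ) [Fact w.Prime] (hw2 : w ≠ 2) (a : ℤ) (p m : ℕ)
    (hm : (m : ℤ) = 4 * p - a ^ 2) (h : (m % w) ^ (w / 2) % w = if w % 4 = 1 then w - 1 else 1) :
    legendreSym w (a ^ 2 - 4 * p) = -1 :=
  (legendreSym.eq_neg_one_iff w).2
    (not_isSquare_disc_of_noroot w hw2 a p (noroot_zmod_of_euler w Fact.out hw2 a p m hm h))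

/-- **Quadratic reciprocity, transfer form.** For odd primes `l, w` with `l ≡ w (mod 4|d|)`: `(d | l) = (d | w)` — the Legendre symbol as a
Jacobi symbol depends only on the lower argument mod `4|d|` (Mathlib `jacobiSym.mod_right`). [cite: Serre1973, Ch. I §3.3 Thm. 6] -/
theorem legendreSym_eq_of_mod_four_mul_eq {l w : ℕ} [Fact l.Prime] [Fact w.Prime] (hl2 : l ≠ 2) (hw2 : w ≠ 2) (d : ℤ)
    (h : l % (4 * d.natAbs) = w % (4 * d.natAbs)) : legendreSym l d = legendreSym w d := by
  rw [jacobiSym.legendreSym.to_jacobiSym, jacobiSym.legendreSym.to_jacobiSym,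
    jacobiSym.mod_right d ((Fact.out : l.Prime).odd_of_ne_two hl2),
    jacobiSym.mod_right d ((Fact.out : w.Prime).odd_of_ne_two hw2), h]

/-- **(P6) ENGINE, INTERVAL FORM WITH RECIPROCITY MASKS.** Data: λ = a/c and `E₁ = [0, −(c²+ac), 0, ac³, 0]`, one multiplicative prime
`q` (`q ∤ c₄`, `Δ = q^k·D`, `q ∤ D`); certificates `t = (p, a_p, m, M)`: `p` good, `a_p(E₁) = a_p`, `0 < m = 4p − a_p²`, a MASK `M` of
residues `r < 4m`; a prime list `F` (product `P`, members `< B`) that is COMPLETE below `B` (`∀ 2 ≤ x < B, gcd x P ≠ 1`); the MASK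
VERIFICATION (one `decide` per certificate): for every `r < 4m` whose bit is set there is `j < jb` such that the witness `w = r + 4m·j`
satisfies `3 ≤ w < B²`, `gcd w P = 1` (so `w` is an odd prime `≡ r (mod 4m)`) and Euler's criterion
`(m % w)^(w/2) % w = (w ≡ 1 mod 4 ? w − 1 : 1)` (so `(a_p² − 4p | w) = −1`, hence `= −1` at EVERY prime `≡ r (mod 4m)` by reciprocity);
a band `lo ≤ l ≤ hi` with `B ≤ lo`, `7 ≤ lo`, `q, k < lo`, walked along the two classes `l ≡ 1, 5 (mod 6)` (`List.range' s₁ n₁ 6`,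
`List.range' s₅ n₅ 6` covering `[lo, hi]`) with the per-level test `gcd l P = 1 → ∃ t ∈ Certs, t.1 ≠ l ∧ M_t / 2^(l % 4m_t) % 2 = 1`
(O(1) kernel arithmetic per level). THEN `Cor22.CondP6 (ratPoint λ) l` for EVERY prime `lo ≤ l ≤ hi`
(`condP6_ratPoint_of_certificate` with the root-freeness from the transferred Legendre symbol).
[cite: Mochizuki2012, IUTchIV Cor. 2.2 (ii) (P6) p.46] [cite: Mazur1978, §6 Prop. 6.3 (1) (p. 153)] [cite: Serre1973, Ch. I §3.3 Thm. 6] -/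
theorem condP6_ratPoint_interval_mask (a c : ℕ) (ha : a ≠ 0) (hc : c ≠ 0) (hac : a ≠ c)
    (q : ℕ) (hq : q.Prime)
    (hc4 : ¬ (q : ℤ) ∣ ((⟨0, -(((c : ℕ) : ℤ) ^ 2 + (a : ℕ) * (c : ℕ)), 0, ((a : ℕ) : ℤ) * ((c : ℕ) : ℤ) ^ 3, 0⟩ : WeierstrassCurve ℤ)).c₄)
    (k : ℕ) (hk0 : 0 < k) (D : ℤ)
    (hΔ : ((⟨0, -(((c : ℕ) : ℤ) ^ 2 + (a : ℕ) * (c : ℕ)), 0, ((a : ℕ) : ℤ) * ((c : ℕ) : ℤ) ^ 3, 0⟩ : WeierstrassCurve ℤ)).Δ = q ^ k * D)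
    (hD : ¬ (q : ℤ) ∣ D)
    (Certs : List (ℕ × ℤ × ℕ × ℕ))
    (hcert : ∀ t ∈ Certs, t.1.Prime ∧
      ¬ (t.1 : ℤ) ∣ ((⟨0, -(((c : ℕ) : ℤ) ^ 2 + (a : ℕ) * (c : ℕ)), 0, ((a : ℕ) : ℤ) * ((c : ℕ) : ℤ) ^ 3, 0⟩ : WeierstrassCurve ℤ)).Δ ∧
      Literature.NumberTheory.Automorphic.frobeniusTrace
        (⟨0, -(((c : ℕ) : ℤ) ^ 2 + (a : ℕ) * (c : ℕ)), 0, ((a : ℕ) : ℤ) * ((c : ℕ) : ℤ) ^ 3, 0⟩ : WeierstrassCurve ℤ) t.1 = t.2.1 ∧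
      (t.2.2.1 : ℤ) = 4 * t.1 - t.2.1 ^ 2 ∧ 0 < t.2.2.1)
    (B P : ℕ) (F : List ℕ) (hFP : F.prod = P) (hF : ∀ x ∈ F, 0 < x ∧ x < B)
    (hFc : ∀ x ∈ List.range' 2 (B - 2), Nat.gcd x P ≠ 1)
    (jb : ℕ)
    (hmask : ∀ t ∈ Certs, ∀ r ∈ List.range' 0 (4 * t.2.2.1), t.2.2.2 / 2 ^ r % 2 = 1 →
      ∃ j ∈ List.range' 0 jb, 3 ≤ r + 4 * t.2.2.1 * j ∧ r + 4 * t.2.2.1 * j < B * B ∧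
        Nat.gcd (r + 4 * t.2.2.1 * j) P = 1 ∧
        (t.2.2.1 % (r + 4 * t.2.2.1 * j)) ^ ((r + 4 * t.2.2.1 * j) / 2) % (r + 4 * t.2.2.1 * j) =
          if (r + 4 * t.2.2.1 * j) % 4 = 1 then r + 4 * t.2.2.1 * j - 1 else 1)
    (lo hi : ℕ) (hBlo : B ≤ lo) (h7 : 7 ≤ lo) (hqlo : q < lo) (hklo : k < lo)
    (s₁ n₁ s₅ n₅ : ℕ) (hs₁ : s₁ % 6 = 1) (hs₅ : s₅ % 6 = 5) (hlo₁ : lo ≤ s₁) (hlo₁' : s₁ < lo + 6)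
    (hlo₅ : lo ≤ s₅) (hlo₅' : s₅ < lo + 6) (hn₁ : hi < s₁ + 6 * n₁) (hn₅ : hi < s₅ + 6 * n₅)
    (hcheck₁ : ∀ l ∈ List.range' s₁ n₁ 6, Nat.gcd l P = 1 →
      ∃ t ∈ Certs, t.1 ≠ l ∧ t.2.2.2 / 2 ^ (l % (4 * t.2.2.1)) % 2 = 1)
    (hcheck₅ : ∀ l ∈ List.range' s₅ n₅ 6, Nat.gcd l P = 1 →
      ∃ t ∈ Certs, t.1 ≠ l ∧ t.2.2.2 / 2 ^ (l % (4 * t.2.2.1)) % 2 = 1) :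
    ∀ l, l.Prime → lo ≤ l → l ≤ hi → Cor22.CondP6 (ratPoint (((a : ℕ) : ℚ) / (c : ℕ))) l := by
  intro l hlp hlo hhi
  have hl5 : l % 6 = 1 ∨ l % 6 = 5 := by
    have h2 : ¬ 2 ∣ l := fun h => by have := (Nat.dvd_prime hlp).1 h; omega
    have h3 : ¬ 3 ∣ l := fun h => by have := (Nat.dvd_prime hlp).1 h; omega
    omega
  have hgl : Nat.gcd l P = 1 :=
    gcd_eq_one_of_prime_of_forall_lt F hFP (fun x hx => ⟨(hF x hx).1, lt_of_lt_of_le (hF x hx).2 hBlo⟩) hlp hlo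
  obtain ⟨t, ht, htl, hbit⟩ : ∃ t ∈ Certs, t.1 ≠ l ∧ t.2.2.2 / 2 ^ (l % (4 * t.2.2.1)) % 2 = 1 := by
    rcases hl5 with h1 | h5
    · exact hcheck₁ l (List.mem_range'.2 ⟨(l - s₁) / 6, by omega, by omega⟩) hgl
    · exact hcheck₅ l (List.mem_range'.2 ⟨(l - s₅) / 6, by omega, by omega⟩) hgl
  obtain ⟨hp, hpΔ, hap, hm, hm0⟩ := hcert t ht
  have hr : l % (4 * t.2.2.1) < 4 * t.2.2.1 := Nat.mod_lt _ (by omega)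
  have hmem : l % (4 * t.2.2.1) ∈ List.range' 0 (4 * t.2.2.1) :=
    List.mem_range'.2 ⟨l % (4 * t.2.2.1), hr, by ring⟩
  obtain ⟨j, -, hw3, hwB, hwg, hweu⟩ := hmask t ht _ hmem hbit
  set w := l % (4 * t.2.2.1) + 4 * t.2.2.1 * j with hwdef
  have hwr : w % (4 * t.2.2.1) = l % (4 * t.2.2.1) := by
    rw [hwdef, Nat.add_mul_mod_self_left, Nat.mod_eq_of_lt hr]
  have hwp : w.Prime := prime_of_gcd_eq_one hFc (by omega) hwB hwg
  have hw2 : w ≠ 2 := by omega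
  have hl2 : l ≠ 2 := by omega
  haveI : Fact w.Prime := ⟨hwp⟩
  haveI : Fact l.Prime := ⟨hlp⟩
  haveI : Fact t.1.Prime := ⟨hp⟩
  have hLw : legendreSym w (t.2.1 ^ 2 - 4 * t.1) = -1 :=
    legendreSym_disc_eq_neg_one_of_euler w hw2 t.2.1 t.1 t.2.2.1 hm hweu
  have hnat : (t.2.1 ^ 2 - 4 * (t.1 : ℤ)).natAbs = t.2.2.1 := by
    rw [show t.2.1 ^ 2 - 4 * (t.1 : ℤ) = -(t.2.2.1 : ℤ) by rw [hm]; ring, Int.natAbs_neg, Int.natAbs_natCast]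
  have hLl : legendreSym l (t.2.1 ^ 2 - 4 * t.1) = -1 := by
    rw [legendreSym_eq_of_mod_four_mul_eq hl2 hw2 (t.2.1 ^ 2 - 4 * (t.1 : ℤ)) (by rw [hnat, hwr]), hLw]
  refine condP6_ratPoint_of_certificate a c ha hc hac l (FreyRef.not_dvd_46080_of_seven_le hlp (by omega)) t.1 htl hpΔ
    ?_ q hq ?_ hc4 k hk0 ?_ D hΔ hD
  · rw [hap]
    exact noroot_of_legendreSym_disc_eq_neg_one l t.2.1 t.1 hLl
  · intro hql
    rcases (Nat.dvd_prime hlp).1 hql with h1 | h1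
    · exact hq.one_lt.ne' h1
    · omega
  · intro hlk
    have := Nat.le_of_dvd hk0 hlk
    omega

end FreyP6Engine

end Summit.ABC.IUTFork.Conditional

end
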